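import Literature.NumberTheory.K2Lit.DoublingEmbedding
import Literature.NumberTheory.K2Lit.SiegelEisensteinSeriesDoubled
import Literature.NumberTheory.Automorphic.UnitaryGroupCohomologicalForms
import HarnessLib

/-!
# Matrix coefficients on the automorphic quotient, the doubling pairing and the doubling zeta integral (a = 0)

Topic `NumberTheory/K2Lit` (Track B build stream 29; planner `hodgecm-mathlib-K2Liu-plan`; DEFS leaf D4(ii) of the DEPMAP, the carriers
of SIG TABLE rows #13 «doubling unfolding» (Liu 2021 Lem. B.11) and #14 «the zeta integral is a section ∕ converges» (Lem. B.10 (4), B.12)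
at `a = 0`). Definitions and proved lemmas only: **no `sorry`, no named fact, no instance, no notation.**

CONVENTIONS (the tree's, ★ `AdelicGroupData.automorphicQuotient` + ★ `toQuotFun`): the automorphic quotient is Mathlib's LEFT coset space
`G(𝔸) ⧸ (A_G·G(K))` with the left action `g • x`; the classical quotient `G(K)\G(𝔸)` is matched by `g ↦ g⁻¹`, so classical RIGHT translation
`(R_g φ)(y) = φ(y g)` reads `x ↦ φ (g⁻¹ • x)` here. Haar ∕ Borel data on `𝒢.Adelic` enter as BINDERS (`[MeasurableSpace 𝒢.Adelic]`, a measure `ν`),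
as in ★ `AdelicGroupDataQuotientUnimodular`. The automorphic side `𝒢 : AdelicGroupData` is bridged to the matrix group
`U(V)(𝔸) = ★ UnitaryGroup.adelic (L⁺) L c (diag dV)` by an explicit homomorphism `ιA` — exactly as the target #184♮
`Liu2021.curveTheta_nonOrthogonal₂` does (its binder `ιA` with the matrix identity `hιA`).

* `quotMatrixCoeff 𝒢 μ φ₁ φ₂ g = ⟨π(g)φ₁, φ₂⟩ = ∫ φ₁(g⁻¹ • x) · conj(φ₂ x) dμ(x)`;
* `toQuotFun₂ 𝒢 Φ` — a function on `G(𝔸) × G(𝔸)` read on `[G] × [G]` (pair version of ★ `toQuotFun`), with `toQuotFun₂_mk`;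
* `doublingPairing 𝒢 μ Eq φ₁ φ₂ = ∫_{[G]×[G]} Eq(x₁, x₂) φ₁(x₁) conj(φ₂(x₂)) d(μ ⊗ μ)` — the LEFT side of the unfolding (Liu (B.7) ∕ Lem. B.11 with
  `Eq = ` the Eisenstein series `E(ι(g₁, g₂); f_s)` read on the quotient);
* `doublingZeta … ν μ ιA f φ₁ φ₂ = ∫_{G(𝔸)} f(ι(ιA g, 1)) · ⟨π(g)φ₁, φ₂⟩ dν(g)` — the RIGHT side (the doubling zeta integral
  `Z(s, f_s, φ₁, φ₂)` when `f = f_s`), `DoublingZetaConverges` (Mathlib `Integrable` of the integrand), `doublingZetaFamily`;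
* sanity: values at the zero section ∕ zero vectors, `quotMatrixCoeff_one`.
References: I. Piatetski-Shapiro, S. Rallis, LNM 1254 (1987) §1 [held: book:gelbart1987-…]; Y. Liu, Invent. Math. 228 (2022) §B.3
(B.7), Lem. B.10–B.12 pp. 101–103; M. Harris, S. Kudla, W. J. Sweet, JAMS 9 (1996) §1 (WANT acq-04821).
-/

noncomputable section

open scoped Matrix
open NumberField IsDedekindDomain MeasureTheory

namespace Literature.NumberTheory.K2Lit.SiegelDoubled

open Literature.NumberTheory.Automorphic Literature.NumberTheory.GaloisRepresentations
open Literature.NumberTheory.GelbartRogawski1991 Literature.NumberTheory.GelbartRogawski1991.GRConstruction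

/-! ## 1. Matrix coefficients and pair descent on the automorphic quotient -/

section Quot

variable {K : Type} [Field K] [NumberField K] (𝒢 : AdelicGroupData.{0} K)

/-- **`⟨π(g)φ₁, φ₂⟩ = ∫_{[G]} φ₁(g⁻¹ • x) conj(φ₂ x) dμ(x)`** — the matrix coefficient of two functions on the automorphic quotient under
right translation (tree convention: `x ↦ g⁻¹ • x`); junk `0` when not integrable. [cite: Liu2021, §B.3 (B.7) p. 101] -/
def quotMatrixCoeff (μ : Measure 𝒢.automorphicQuotient) (φ₁ φ₂ : 𝒢.automorphicQuotient → ℂ) (g : 𝒢.Adelic) : ℂ :=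
  ∫ x, φ₁ (g⁻¹ • x) * starRingEnd ℂ (φ₂ x) ∂μ

/-- At `g = 1` the matrix coefficient is the `L²` pairing `∫ φ₁ conj(φ₂)`. [cite: Liu2021, §B.3 (B.7) p. 101] -/
theorem quotMatrixCoeff_one (μ : Measure 𝒢.automorphicQuotient) (φ₁ φ₂ : 𝒢.automorphicQuotient → ℂ) :
    quotMatrixCoeff 𝒢 μ φ₁ φ₂ 1 = ∫ x, φ₁ x * starRingEnd ℂ (φ₂ x) ∂μ := by
  simp [quotMatrixCoeff]

/-- The matrix coefficient vanishes for `φ₁ = 0`. [cite: Liu2021, §B.3 (B.7) p. 101] -/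
theorem quotMatrixCoeff_zero_left (μ : Measure 𝒢.automorphicQuotient) (φ₂ : 𝒢.automorphicQuotient → ℂ) (g : 𝒢.Adelic) :
    quotMatrixCoeff 𝒢 μ (fun _ => 0) φ₂ g = 0 := by
  simp [quotMatrixCoeff]

/-- The matrix coefficient vanishes for `φ₂ = 0`. [cite: Liu2021, §B.3 (B.7) p. 101] -/
theorem quotMatrixCoeff_zero_right (μ : Measure 𝒢.automorphicQuotient) (φ₁ : 𝒢.automorphicQuotient → ℂ) (g : 𝒢.Adelic) :
    quotMatrixCoeff 𝒢 μ φ₁ (fun _ => 0) g = 0 := by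
  simp [quotMatrixCoeff]

/-- **A function on `G(𝔸) × G(𝔸)` read on `[G] × [G]`**: `(x₁, x₂) ↦ Φ((out x₁)⁻¹, (out x₂)⁻¹)` — the pair version of ★ `toQuotFun`
(well defined on left-`A_G G(K)`-invariant `Φ`, `toQuotFun₂_mk`). [cite: Liu2021, §B.3 (B.7) p. 101] -/
def toQuotFun₂ (Φ : 𝒢.Adelic × 𝒢.Adelic → ℂ) : 𝒢.automorphicQuotient × 𝒢.automorphicQuotient → ℂ :=
  fun x => Φ (((Quotient.out (x.1 : 𝒢.Adelic ⧸ 𝒢.quotientSubgroup)) : 𝒢.Adelic)⁻¹,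
    ((Quotient.out (x.2 : 𝒢.Adelic ⧸ 𝒢.quotientSubgroup)) : 𝒢.Adelic)⁻¹)

variable {𝒢} in
/-- For `Φ` left-invariant under `A_G G(K)` in each variable, `toQuotFun₂ Φ ([g₁], [g₂]) = Φ (g₁⁻¹, g₂⁻¹)`.
[cite: Liu2021, §B.3 (B.7) p. 101] -/
theorem toQuotFun₂_mk {Φ : 𝒢.Adelic × 𝒢.Adelic → ℂ}
    (h₁ : ∀ γ ∈ 𝒢.quotientSubgroup, ∀ g₁ g₂, Φ (γ * g₁, g₂) = Φ (g₁, g₂))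
    (h₂ : ∀ γ ∈ 𝒢.quotientSubgroup, ∀ g₁ g₂, Φ (g₁, γ * g₂) = Φ (g₁, g₂)) (g₁ g₂ : 𝒢.Adelic) :
    toQuotFun₂ 𝒢 Φ (𝒢.toAutomorphicQuotient g₁, 𝒢.toAutomorphicQuotient g₂) = Φ (g₁⁻¹, g₂⁻¹) := by
  obtain ⟨k₁, hk₁⟩ := QuotientGroup.mk_out_eq_mul 𝒢.quotientSubgroup g₁
  obtain ⟨k₂, hk₂⟩ := QuotientGroup.mk_out_eq_mul 𝒢.quotientSubgroup g₂
  show Φ (((Quotient.out (QuotientGroup.mk g₁ : 𝒢.Adelic ⧸ 𝒢.quotientSubgroup)) : 𝒢.Adelic)⁻¹,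
      ((Quotient.out (QuotientGroup.mk g₂ : 𝒢.Adelic ⧸ 𝒢.quotientSubgroup)) : 𝒢.Adelic)⁻¹) = Φ (g₁⁻¹, g₂⁻¹)
  rw [hk₁, hk₂, mul_inv_rev, mul_inv_rev, h₁ _ (inv_mem k₁.2), h₂ _ (inv_mem k₂.2)]

/-- **The doubling pairing** `∫_{[G]×[G]} Eq(x₁, x₂) φ₁(x₁) conj(φ₂(x₂)) d(μ ⊗ μ)` — the left side of the unfolding identity, with `Eq` the
Eisenstein series `E(ι(g₁, g₂); f_s)` read on `[G] × [G]`; junk `0` when not integrable. [cite: Liu2021, Lem. B.11 p. 102] -/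
def doublingPairing (μ : Measure 𝒢.automorphicQuotient) (Eq : 𝒢.automorphicQuotient × 𝒢.automorphicQuotient → ℂ)
    (φ₁ φ₂ : 𝒢.automorphicQuotient → ℂ) : ℂ :=
  ∫ x, Eq x * φ₁ x.1 * starRingEnd ℂ (φ₂ x.2) ∂(μ.prod μ)

/-- The doubling pairing against `Eq = 0` vanishes. [cite: Liu2021, Lem. B.11 p. 102] -/
theorem doublingPairing_zero (μ : Measure 𝒢.automorphicQuotient) (φ₁ φ₂ : 𝒢.automorphicQuotient → ℂ) :
    doublingPairing 𝒢 μ (fun _ => 0) φ₁ φ₂ = 0 := by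
  simp [doublingPairing]

end Quot

/-! ## 2. The doubling zeta integral -/

variable (L : Type) [Field L] [NumberField L] [IsCMField L]
variable {N M n : ℕ} (e : Fin N × Fin M ≃ Fin n)
  (dV : Fin N → L) (hdV : ∀ i, IsCMField.complexConj L (dV i) = dV i)
  (dW : Fin M → L) (hdW : ∀ i, IsCMField.complexConj L (dW i) = dW i)
variable (𝒢 : AdelicGroupData.{0} (Fp L)) [MeasurableSpace 𝒢.Adelic]

/-- **The doubling zeta integral** `Z(f, φ₁, φ₂) = ∫_{G(𝔸)} f(ι(ιA g, 1)) · ⟨π(g)φ₁, φ₂⟩ dν(g)` (`f` a Siegel section on `H(𝔸)`, `ν` a Haar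
measure on `G(𝔸)`, `ιA : 𝒢.Adelic →* U(V)(𝔸)` the bridge to the matrix group); junk `0` when not integrable.
[cite: Liu2021, Lem. B.11 p. 102] [cite: HarrisKudlaSweet1996, §1] -/
def doublingZeta (ν : Measure 𝒢.Adelic) (μ : Measure 𝒢.automorphicQuotient)
    (ιA : 𝒢.Adelic →* UnitaryGroup.adelic (Fp L) L (IsCMField.complexConj L) N (Matrix.diagonal dV))
    (f : HA L e dV hdV dW hdW → ℂ) (φ₁ φ₂ : 𝒢.automorphicQuotient → ℂ) : ℂ :=
  ∫ g, f (iotaLeft L e dV hdV dW hdW (ιA g)) * quotMatrixCoeff 𝒢 μ φ₁ φ₂ g ∂ν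

/-- **Absolute convergence of the doubling zeta integral** (Mathlib `Integrable` of the integrand) — the content of Liu Lem. B.10 (4) ∕
B.12 at `a = 0` for `Re s > n/2`, standard `f_s`, cuspidal `φᵢ`. [cite: Liu2021, Lem. B.10 (4) p. 102] -/
def DoublingZetaConverges (ν : Measure 𝒢.Adelic) (μ : Measure 𝒢.automorphicQuotient)
    (ιA : 𝒢.Adelic →* UnitaryGroup.adelic (Fp L) L (IsCMField.complexConj L) N (Matrix.diagonal dV))
    (f : HA L e dV hdV dW hdW → ℂ) (φ₁ φ₂ : 𝒢.automorphicQuotient → ℂ) : Prop :=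
  Integrable (fun g => f (iotaLeft L e dV hdV dW hdW (ιA g)) * quotMatrixCoeff 𝒢 μ φ₁ φ₂ g) ν

/-- `Z(s, f_s, φ₁, φ₂)` for a family of sections `s ↦ f_s`. [cite: Liu2021, Lem. B.12 p. 103] -/
def doublingZetaFamily (ν : Measure 𝒢.Adelic) (μ : Measure 𝒢.automorphicQuotient)
    (ιA : 𝒢.Adelic →* UnitaryGroup.adelic (Fp L) L (IsCMField.complexConj L) N (Matrix.diagonal dV))
    (f : ℂ → HA L e dV hdV dW hdW → ℂ) (φ₁ φ₂ : 𝒢.automorphicQuotient → ℂ) (s : ℂ) : ℂ :=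
  doublingZeta L e dV hdV dW hdW 𝒢 ν μ ιA (f s) φ₁ φ₂

/-- The zeta integral of the zero section vanishes. [cite: Liu2021, Lem. B.11 p. 102] -/
theorem doublingZeta_zero_section (ν : Measure 𝒢.Adelic) (μ : Measure 𝒢.automorphicQuotient)
    (ιA : 𝒢.Adelic →* UnitaryGroup.adelic (Fp L) L (IsCMField.complexConj L) N (Matrix.diagonal dV))
    (φ₁ φ₂ : 𝒢.automorphicQuotient → ℂ) :
    doublingZeta L e dV hdV dW hdW 𝒢 ν μ ιA (fun _ => 0) φ₁ φ₂ = 0 := by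
  simp [doublingZeta]

/-- The zeta integral vanishes for `φ₁ = 0`. [cite: Liu2021, Lem. B.11 p. 102] -/
theorem doublingZeta_zero_left (ν : Measure 𝒢.Adelic) (μ : Measure 𝒢.automorphicQuotient)
    (ιA : 𝒢.Adelic →* UnitaryGroup.adelic (Fp L) L (IsCMField.complexConj L) N (Matrix.diagonal dV))
    (f : HA L e dV hdV dW hdW → ℂ) (φ₂ : 𝒢.automorphicQuotient → ℂ) :
    doublingZeta L e dV hdV dW hdW 𝒢 ν μ ιA f (fun _ => 0) φ₂ = 0 := by
  simp [doublingZeta, quotMatrixCoeff_zero_left]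

/-- The zero section's zeta integral converges (trivially). [cite: Liu2021, Lem. B.10 (4) p. 102] -/
theorem doublingZetaConverges_zero_section (ν : Measure 𝒢.Adelic) (μ : Measure 𝒢.automorphicQuotient)
    (ιA : 𝒢.Adelic →* UnitaryGroup.adelic (Fp L) L (IsCMField.complexConj L) N (Matrix.diagonal dV))
    (φ₁ φ₂ : 𝒢.automorphicQuotient → ℂ) :
    DoublingZetaConverges L e dV hdV dW hdW 𝒢 ν μ ιA (fun _ => 0) φ₁ φ₂ := by
  simp [DoublingZetaConverges]

/-- **The Eisenstein pull-back** `(g₁, g₂) ↦ E(ι(ιA g₁, ιA g₂); f)` on `G(𝔸) × G(𝔸)` (to be read on `[G] × [G]` by `toQuotFun₂` — its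
left-invariance under `G(K) × G(K)` is ★ `sig_K2LiuSiegelEisensteinDoubledLeftInvariant` composed with `ι`). [cite: Liu2021, Lem. B.11 p. 102] -/
def eisensteinPullback (ιA : 𝒢.Adelic →* UnitaryGroup.adelic (Fp L) L (IsCMField.complexConj L) N (Matrix.diagonal dV))
    (f : HA L e dV hdV dW hdW → ℂ) : 𝒢.Adelic × 𝒢.Adelic → ℂ :=
  fun g => eisensteinSeriesDelta L e dV hdV dW hdW f (iotaV L e dV hdV dW hdW (ιA g.1, ιA g.2))

end Literature.NumberTheory.K2Lit.SiegelDoubled
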